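import Summits.NavierStokesRegularity.NavierStokesRegularity.Theorems.FluidComputerCalibrationPump
import Summits.NavierStokesRegularity.NavierStokesRegularity.Theorems.PerpetualPumpThesisBilinearOperatorWeighted
import Literature.Analysis.FluidPDE.FluidComputer.RobustPumpCascade
import HarnessLib

/-!
# Fluid computer blueprint — summit-side glue for the ROBUST pump cascade: stable clocked blow-up

HONEST FRAMING: low prior, high value-of-information experiment on Tao's machine paradigm; NOT a
claim that NS blows up. Nothing in this file or its imports constructs a `RobustPumpCascade`; every
theorem below is an implication from such a (so far uninhabited) structure, or a statement about
which scenarios CANNOT inhabit it.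

`Literature.Analysis.FluidPDE.FluidComputer.RobustPumpCascade S s ρ` (blueprint recommendation R1)
adds to `PumpCascade S` a typed NOISE TOLERANCE: the generation-`(n+1)` input class contains the
`X^s_{λ_{n+1}}`-ball (scale-adapted Sobolev norm `scaledSobolevNorm s κ`) of radius `ρ√E_{n+1}`
around every output state of generation `n`, within `H¹⁰_df` (`margin`), and the generation-`0`
input class contains the same ball around the ignition datum (`igniteBall`). This file draws the
summit-side conclusions, discharging `MemH10df (schwartzL2 w₀)` for divergence-free Schwartz data by
the in-tree `PumpContinuationSchwartzData.memH10df_schwartzL2` and the two named standard facts by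
`h10MildTheory_holds` / `mildMaximalGivesBlowup_holds` (`FluidComputerCascade.lean`):

* `ns_blowup_of_robustPumpCascade` — `¬ NavierStokesRegularity` (`α > 0`, `η > 1/4`), as for any
  pump cascade;
* `stableBlowup_of_robustPumpCascade` — STABLE BLOW-UP: every `H¹⁰_df`-mild Navier–Stokes trajectory
  from every divergence-free Schwartz datum within `X^s_{λ₀}`-distance `ρ√E₀` of the ignition datum
  has lifespan `≤ T_* = ∑ Cλ_n^{-α}`; `stableBlowup_H10ball` — the same for the `H¹⁰`-ball of that
  radius when `0 ≤ s ≤ 10` and `λ₀ ≥ 1` (Tao's own stability class, §4 footnote: "blowup for a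
  non-empty open set of initial data in smooth topologies"); `normBlowup_of_near_seed` — each such
  datum has a maximal mild solution with unbounded `H¹⁰` norm by `T_*`;
* `stableBlowup_at_generation` — uniformly in the generation: every divergence-free Schwartz datum
  within `X^s_{λ_{k+1}}`-distance `ρ√E_{k+1}` of ANY output state of generation `k` has all its mild
  trajectories of lifespan `≤ ∑_{m>k} Cλ_m^{-α} ≤ T_*`;
* `no_robustPumpCascade_of_unstable` — if divergence-free Schwartz data with a mild solution living
  PAST `T_*` come `X^s_{λ₀}`-arbitrarily close to `u₀`, then no robust pump cascade (`ρ > 0`) is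
  seeded at `u₀`; and `pumpCascade_not_robust_of_unstableProfile` — in that scenario a clocked
  blow-up profile at `u₀` still inhabits `PumpCascade S` (calibration converse
  `exists_pumpCascade_of_clockedProfile`) but NOT `RobustPumpCascade S s ρ`: the single-orbit
  calibration of the plain interface does not lift to the robust one — its content is exactly the
  STABILITY of the clocked blow-up, which no soft argument supplies (local well-posedness makes the
  lifespan lower semicontinuous in the datum, never upper semicontinuous).
-/

set_option linter.dupNamespace false

noncomputable section

open Set Filter Topology
open scoped SchwartzMap ENNReal

namespace Summit.NavierStokesRegularity.NavierStokesRegularity.Theorems.FluidComputer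

open Literature.Analysis.FluidPDE Literature.Analysis.FluidPDE.Tao2016
open Literature.Analysis.FluidPDE.FluidComputer
open Literature.Analysis.FunctionSpaces (eFourierSobolevNorm)

variable {S : CascadeSpecs} {s ρ : ℝ}

/-- **A robust pump cascade for the true Navier–Stokes equations refutes Clay (A)** (`α > 0`,
`η > 1/4`) — through its underlying pump cascade. HONEST FRAMING: an implication from an
uninhabited-as-far-as-known structure; NOT a claim that NS blows up. -/
theorem ns_blowup_of_robustPumpCascade (R : RobustPumpCascade S s ρ) (hα : 0 < S.alpha)
    (hη : 1 / 4 < S.eta) : ¬ NavierStokesRegularity :=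
  ns_blowup_of_pumpCascade R.toPumpCascade hα hη

/-- **Stable blow-up from a robust pump cascade** (`α > 0`, `η > 1/4`): every `H¹⁰_df`-mild
Navier–Stokes trajectory from every divergence-free Schwartz datum within `X^s_{λ₀}`-distance `ρ√E₀`
of the ignition datum has lifespan at most `T_* = ∑ Cλ_n^{-α}` — a BALL of blow-up data (empty
hypothesis when `ρ ≤ 0`). Uses only the `igniteBall` field. -/
theorem stableBlowup_of_robustPumpCascade (R : RobustPumpCascade S s ρ) (hα : 0 < S.alpha)
    (hη : 1 / 4 < S.eta) (w₀ : 𝓢(EuclideanSpace ℝ (Fin 3), EuclideanSpace ℝ (Fin 3)))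
    (hdiv : VectorCalculus.IsDivFree ⇑w₀)
    (hnear : scaledSobolevNorm s (S.lam 0) (schwartzL2 w₀ - schwartzL2 R.u₀) <
      ENNReal.ofReal (ρ * Real.sqrt (S.Emin 0)))
    {S' : ℝ} {u : ℝ → L2C} (hu : IsMildSolutionFor eulerForm (schwartzL2 w₀) (Ico 0 S') u) :
    S' ≤ S.Tstar :=
  R.lifespan_le_of_near hα hη w₀ hdiv (PumpContinuationSchwartzData.memH10df_schwartzL2 w₀ hdiv)
    hnear hu

/-- **Stable blow-up on an `H¹⁰`-ball** (Tao's stability class, §4 footnote of the 2016 paper,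
transposed to the true equations): for a robust pump cascade with `0 ≤ s ≤ 10`, base frequency
`λ₀ ≥ 1`, `α > 0`, `η > 1/4`, every divergence-free Schwartz datum `w₀` with
`‖w₀ - u₀‖_{H¹⁰} < ρ√E₀` has all its `H¹⁰_df`-mild Navier–Stokes trajectories of lifespan `≤ T_*`
("blowup for a non-empty open set of initial data in smooth topologies"). -/
theorem stableBlowup_H10ball (R : RobustPumpCascade S s ρ) (hs0 : 0 ≤ s) (hs10 : s ≤ 10)
    (hlam : 1 ≤ S.lam0) (hα : 0 < S.alpha) (hη : 1 / 4 < S.eta)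
    (w₀ : 𝓢(EuclideanSpace ℝ (Fin 3), EuclideanSpace ℝ (Fin 3)))
    (hdiv : VectorCalculus.IsDivFree ⇑w₀)
    (hnear : eFourierSobolevNorm 10 (schwartzL2 w₀ - schwartzL2 R.u₀) <
      ENNReal.ofReal (ρ * Real.sqrt (S.Emin 0)))
    {S' : ℝ} {u : ℝ → L2C} (hu : IsMildSolutionFor eulerForm (schwartzL2 w₀) (Ico 0 S') u) :
    S' ≤ S.Tstar := by
  have hlam0 : 1 ≤ S.lam 0 := by simpa [CascadeSpecs.lam] using hlam
  refine stableBlowup_of_robustPumpCascade R hα hη w₀ hdiv (lt_of_le_of_lt ?_ hnear) hu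
  exact (scaledSobolevNorm_le_eFourierSobolevNorm hs0 hlam0 _).trans
    (PerpetualPumpThesis.B.eFourierSobolevNorm_mono hs10 _)

/-- **`H¹⁰`-norm blow-up near the seed**: every divergence-free Schwartz datum in the ignition ball
of a robust pump cascade (`α > 0`, `η > 1/4`) has a maximal `H¹⁰_df`-mild Navier–Stokes solution on
some `[0, S_m)`, `S_m ≤ T_*`, with unbounded `H¹⁰` norm — unconditional given the cascade
(`h10MildTheory_holds`). -/
theorem normBlowup_of_near_seed (R : RobustPumpCascade S s ρ) (hα : 0 < S.alpha)
    (hη : 1 / 4 < S.eta) (w₀ : 𝓢(EuclideanSpace ℝ (Fin 3), EuclideanSpace ℝ (Fin 3)))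
    (hdiv : VectorCalculus.IsDivFree ⇑w₀)
    (hnear : scaledSobolevNorm s (S.lam 0) (schwartzL2 w₀ - schwartzL2 R.u₀) <
      ENNReal.ofReal (ρ * Real.sqrt (S.Emin 0))) :
    ∃ Sm : ℝ, 0 < Sm ∧ Sm ≤ S.Tstar ∧ ∃ U : ℝ → L2C,
      IsMildSolutionFor eulerForm (schwartzL2 w₀) (Ico 0 Sm) U ∧
      ∀ C : ℝ, ∃ t ∈ Ico 0 Sm, ENNReal.ofReal C < eFourierSobolevNorm 10 (U t) :=
  R.normBlowup_of_near h10MildTheory_holds hα hη w₀ hdiv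
    (PumpContinuationSchwartzData.memH10df_schwartzL2 w₀ hdiv) hnear

/-- **X5a near the seed**: every divergence-free Schwartz datum in the ignition ball of a robust
pump cascade (`α > 0`, `η > 1/4`) yields the classical blow-up object X5a (a finite-energy classical
Leray–Hopf solution from a rapidly decaying datum with finite maximal time of smooth existence). -/
theorem x5a_of_near_seed (R : RobustPumpCascade S s ρ) (hα : 0 < S.alpha) (hη : 1 / 4 < S.eta)
    (w₀ : 𝓢(EuclideanSpace ℝ (Fin 3), EuclideanSpace ℝ (Fin 3)))
    (hdiv : VectorCalculus.IsDivFree ⇑w₀)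
    (hnear : scaledSobolevNorm s (S.lam 0) (schwartzL2 w₀ - schwartzL2 R.u₀) <
      ENNReal.ofReal (ρ * Real.sqrt (S.Emin 0))) :
    ∃ ν : ℝ, 0 < ν ∧ ∃ T : ℝ, 0 < T ∧
      ∃ (u : ℝ → EuclideanSpace ℝ (Fin 3) → EuclideanSpace ℝ (Fin 3))
        (p : ℝ → EuclideanSpace ℝ (Fin 3) → ℝ),
        IsMaximalSmoothSolution ν 0 u p T ∧ IsLerayHopfOn T ν 0 (u 0) u ∧ HasRapidSpatialDecay (u 0) :=
  R.x5a_of_near h10MildTheory_holds mildMaximalGivesBlowup_holds hα hη w₀ hdiv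
    (PumpContinuationSchwartzData.memH10df_schwartzL2 w₀ hdiv) hnear

/-- **Stable blow-up at every generation** (the typed noise tolerance at work; uses only the
`margin` field): for a robust pump cascade with `α > 0`, `η > 1/4`, every divergence-free Schwartz
datum within `X^s_{λ_{k+1}}`-distance `ρ√E_{k+1}` of ANY output state of generation `k` has all its
`H¹⁰_df`-mild Navier–Stokes trajectories of lifespan at most the tail budget
`T_*(shift (k+1)) = ∑_{m>k} Cλ_m^{-α}`, itself at most `T_*`. -/
theorem stableBlowup_at_generation (R : RobustPumpCascade S s ρ) (hα : 0 < S.alpha)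
    (hη : 1 / 4 < S.eta) (k : ℕ) {v : L2C} (hv : v ∈ (R.G k).Out)
    (w₀ : 𝓢(EuclideanSpace ℝ (Fin 3), EuclideanSpace ℝ (Fin 3)))
    (hdiv : VectorCalculus.IsDivFree ⇑w₀)
    (hnear : scaledSobolevNorm s (S.lam (k + 1)) (schwartzL2 w₀ - v) <
      ENNReal.ofReal (ρ * Real.sqrt (S.Emin (k + 1))))
    {S' : ℝ} {u : ℝ → L2C} (hu : IsMildSolutionFor eulerForm (schwartzL2 w₀) (Ico 0 S') u) :
    S' ≤ (S.shift (k + 1)).Tstar ∧ (S.shift (k + 1)).Tstar ≤ S.Tstar :=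
  ⟨R.lifespan_le_of_near_output hα hη k hv w₀ hdiv
      (PumpContinuationSchwartzData.memH10df_schwartzL2 w₀ hdiv) hnear hu,
    S.shift_Tstar_le hα (k + 1)⟩

/-- **Unstable blow-up admits no robust cascade.** If divergence-free Schwartz data having an
`H¹⁰_df`-mild Navier–Stokes solution on some `[0,S')` with `S' > T_*` come `X^s_{λ₀}`-arbitrarily
close to `u₀`, then (`α > 0`, `η > 1/4`, `ρ > 0`) no robust pump cascade over `S` with tolerance
`ρ` in `X^s` is seeded at `u₀` — whatever happens to the trajectory of `u₀` itself. -/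
theorem no_robustPumpCascade_of_unstable (hα : 0 < S.alpha) (hη : 1 / 4 < S.eta) (hρ : 0 < ρ)
    (u₀ : 𝓢(EuclideanSpace ℝ (Fin 3), EuclideanSpace ℝ (Fin 3)))
    (hacc : ∀ ε : ℝ, 0 < ε →
      ∃ w₀ : 𝓢(EuclideanSpace ℝ (Fin 3), EuclideanSpace ℝ (Fin 3)),
        VectorCalculus.IsDivFree ⇑w₀ ∧
        scaledSobolevNorm s (S.lam 0) (schwartzL2 w₀ - schwartzL2 u₀) < ENNReal.ofReal ε ∧
        ∃ S' : ℝ, S.Tstar < S' ∧ ∃ u : ℝ → L2C,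
          IsMildSolutionFor eulerForm (schwartzL2 w₀) (Ico 0 S') u)
    (R : RobustPumpCascade S s ρ) (hR : R.u₀ = u₀) : False := by
  obtain ⟨w₀, hdiv, hnear, S', hS', u, hu⟩ :=
    hacc (ρ * Real.sqrt (S.Emin 0)) (mul_pos hρ (Real.sqrt_pos.2 (S.Emin_pos 0)))
  subst hR
  exact R.no_longLived_near hα hη w₀ hdiv (PumpContinuationSchwartzData.memH10df_schwartzL2 w₀ hdiv)
    hnear hS' hu

/-- **The single-orbit calibration does not lift to the robust interface.** In the scenario of an
UNSTABLE clocked blow-up — a divergence-free Schwartz datum `u₀` whose mild Navier–Stokes trajectory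
`U` on `[0,S_m)` carries a clock `t n ↑` with `t(n+1) - t n ≤ Cλ_n^{-α}` and the high-frequency
energy floors `E₀ηⁿ` at scales `λ_n` on the orbit tails (the hypotheses of
`exists_pumpCascade_of_clockedProfile`), while long-lived divergence-free Schwartz data accumulate
at `u₀` in `X^s_{λ₀}` — the plain interface `PumpCascade S` IS inhabited with seed `u₀` but the
robust one `RobustPumpCascade S s ρ` (`ρ > 0`) is NOT. HONEST FRAMING: no such scenario is known
for the true equations either; the theorem separates the two interfaces modulo it, locating the
robust interface's content in the STABILITY of the clocked blow-up. -/
theorem pumpCascade_not_robust_of_unstableProfile (S : CascadeSpecs) (hα : 0 < S.alpha)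
    (hη : 1 / 4 < S.eta) (hρ : 0 < ρ)
    (u₀ : 𝓢(EuclideanSpace ℝ (Fin 3), EuclideanSpace ℝ (Fin 3)))
    (hdiv : VectorCalculus.IsDivFree ⇑u₀) {Sm : ℝ} (hSm : 0 < Sm) {U : ℝ → L2C}
    (hU : IsMildSolutionFor eulerForm (schwartzL2 u₀) (Ico 0 Sm) U)
    (t : ℕ → ℝ) (ht0 : t 0 = 0) (htmono : Monotone t) (htlt : ∀ n, t n < Sm)
    (htime : ∀ n, t (n + 1) - t n ≤ S.Tmax n)
    (hfloor : ∀ n, ∀ s ∈ Ico (t n) Sm,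
      ENNReal.ofReal (S.Emin n) ≤ highFreqEnergy (S.lam n) (U s))
    (hacc : ∀ ε : ℝ, 0 < ε →
      ∃ w₀ : 𝓢(EuclideanSpace ℝ (Fin 3), EuclideanSpace ℝ (Fin 3)),
        VectorCalculus.IsDivFree ⇑w₀ ∧
        scaledSobolevNorm s (S.lam 0) (schwartzL2 w₀ - schwartzL2 u₀) < ENNReal.ofReal ε ∧
        ∃ S' : ℝ, S.Tstar < S' ∧ ∃ u : ℝ → L2C,
          IsMildSolutionFor eulerForm (schwartzL2 w₀) (Ico 0 S') u) :
    (∃ L : PumpCascade S, L.u₀ = u₀) ∧ ¬ ∃ R : RobustPumpCascade S s ρ, R.u₀ = u₀ := by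
  refine ⟨?_, fun ⟨R, hR⟩ => no_robustPumpCascade_of_unstable hα hη hρ u₀ hacc R hR⟩
  obtain ⟨L, hL, -⟩ :=
    exists_pumpCascade_of_clockedProfile S u₀ hdiv hSm hU t ht0 htmono htlt htime hfloor
  exact ⟨L, hL⟩

end Summit.NavierStokesRegularity.NavierStokesRegularity.Theorems.FluidComputer

end
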